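import Literature.Computability.Cryptography.VanDamSeroussiOracleBQP
import Summits.QuantumAdvantage.QuantumAdvantage.Theorems.ArithStatLadderAvgFaceBeyondPriorMirrorUnitData
import Literature.Computability.Cryptography.HallgrenPellQuantum
import Literature.Computability.Cryptography.HallgrenPellProofs
import Mathlib.Algebra.QuadraticAlgebra.Basic

/-!
# QuantumAdvantage / ArithStatLadder — `AvgFaceBeyondPrior`, line `mirror-unit-signature`:
# the certified unit language is in `BQP` (part CU-2 of stub `stub_oracleLangMemBQP`; support item
# `UnitCubeMemBQP`, stmt-QuantumAdvantage-15005)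

The certified unit language

  `CU = {⟨bin d, code(primeFactorsList d)⟩ : −d fundamental, d ≠ 3, UnitCubeAtThree d}`

is in `BQP` (`certUnitLang_mem_BQP_of_guard`, stated over its classical guard — the polynomial-time test
`good w ⟺ w = ⟨bin d, code(primeFactorsList d)⟩ ∧ −d fundamental ∧ d ≠ 3`, which is `exists_goodFn` of
`…CertUnitChecks.lean`, supplied by the closing file). The decision procedure is ONE classical wrap
(`isQSolvable_classicalWrap_holds`, Bernstein–Vazirani 1997, §8) around Hallgren's regulator algorithm in
its self-delimiting form (`Hallgren2007_regulator_qsolvable_delim_holds`, Hallgren 2007 via Jozsa 2003,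
Thm 7 — PROVED in the tree, no Riemann hypothesis):

* pre-processor (`FP`): `w ↦ bin d₀`, `d₀ = mirrorRadicand ⟦fstF w⟧` (`codeFP_mirrorRadicand`);
* quantum step: on `bin d₀`, `d₀ ≥ 2` square-free, a string `⟨bin m, junk⟩` with `m ∈ {⌊R⌋, ⌈R⌉}`, `R` the
  regulator of `ℚ(√d₀)` (for the parse we fix ONE quadratic number field `K ∋ √d₀`,
  `exists_numberField_sq_eq_natCast`, Mathlib's `QuadraticAlgebra ℚ d₀ 0`);
* post-processor (`FP`): the classical guard `good` (`w` is `⟨bin d, code(primeFactorsList d)⟩` with `−d`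
  fundamental, `d ≠ 3`), then Jacobson–Williams
  (`JacobsonWilliams2008_unitResidue_mem_FP_holds`, PROVED): `(a mod 9, b mod 9)` of the fundamental unit
  `(a + b√d₀)/2` from `(d₀, m, 9)` — its promise `|log((a + b√d₀)/2) − m| < 1` is the landed
  `stub_mirrorUnitData` —, then `(x + y√d₀)⁸ = X + Y√d₀` on the residues `(x, y) = (a mod 9, b mod 9)` by
  three squarings (`exists_pow8Fn`) and the test `X ≡ 4 (9)`, `9 ∣ Y` (if `3 ∣ d`) / `3 ∣ Y` (if `3 ∤ d`)
  (`exists_unitTestFn`); residues suffice because `z ≡ z' (mod 9ℤ[√d₀])` implies `z⁸ ≡ z'⁸`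
  (`zsqrtd_pow_eight_emod_nine`), and the test on THE fundamental solution is `UnitCubeAtThree d` by the
  uniqueness clause of `stub_mirrorUnitData` (`unitCubeAtThree_iff_of_isMirrorFundUnit`);
* decision from the written bit (`mem_BQP_of_isQSolvable_bit`).

Everything used is proved in the tree; no definition, no named-fact hypothesis.

## References

* S. Hallgren, J. ACM 54 (2007), Art. 4; R. Jozsa, arXiv:quant-ph/0302134, §10 Thm 7.
* M. J. Jacobson, H. C. Williams, *Solving the Pell Equation*, CMS Books, Springer 2009, Ch. 12–13.
* E. Bernstein, U. Vazirani, SIAM J. Comput. 26 (1997), §8.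
-/

set_option linter.dupNamespace false -- D-0017: single-problem summit ⇒ `QuantumAdvantage.QuantumAdvantage` by design

namespace Summit.QuantumAdvantage.QuantumAdvantage.Theorems.AvgFaceBeyondPrior.Mirror

open _root_.Computability
open Literature.Computability.Complexity Literature.Computability.Cryptography
  Literature.NumberTheory.QuadraticFields
open Literature.Computability.Complexity.Brick Literature.Computability.Complexity.CodeFP

/-! ### A quadratic number field containing `√n` -/

/-- For `n ≥ 2` square-free there is a quadratic number field containing a square root of `n`
(Mathlib's `QuadraticAlgebra ℚ n 0`; `n` is not a rational square). [folklore] -/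
theorem exists_numberField_sq_eq_natCast {n : ℕ} (hsf : Squarefree n) (h2 : 2 ≤ n) :
    ∃ (K : Type) (_ : Field K) (_ : NumberField K),
      Module.finrank ℚ K = 2 ∧ ∃ α : K, α ^ 2 = (n : K) := by
  have hns : ∀ r : ℚ, r ^ 2 ≠ (n : ℚ) := fun r hr =>
    Quadratic.not_isSquare_of_squarefree hsf h2 (Rat.isSquare_natCast_iff.1 ⟨r, by rw [← hr, sq]⟩)
  haveI : Fact (∀ r : ℚ, r ^ 2 ≠ (n : ℚ) + 0 * r) := ⟨fun r h => hns r (by rw [h]; ring)⟩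
  haveI : NumberField (QuadraticAlgebra ℚ (n : ℚ) 0) := NumberField.of_module_finite ℚ _
  refine ⟨QuadraticAlgebra ℚ (n : ℚ) 0, inferInstance, inferInstance,
    by convert QuadraticAlgebra.finrank_eq_two (n : ℚ) (0 : ℚ), QuadraticAlgebra.omega, ?_⟩
  have h := QuadraticAlgebra.omega_mul_omega_eq_add (a := (n : ℚ)) (b := (0 : ℚ))
  rw [zero_smul, add_zero] at h
  rw [sq, h, ← Algebra.algebraMap_eq_smul_one, map_natCast]

/-! ### Hallgren's answer, parsed -/

/-- **Parsing Hallgren's self-delimited answer.** If `y` satisfies the promise clause of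
`Hallgren2007_regulator_qsolvable_delim` at an input decoding to a square-free `n ≥ 2`, then for SOME
quadratic number field `K ∋ √n` the first field of `y` is a numeral of `⌊R_K⌋₊` or `⌈R_K⌉₊`.
[cite: Jozsa2003, §10 Thm 7] -/
theorem exists_field_of_hallgrenAnswer {n : ℕ} (hsf : Squarefree n) (h2 : 2 ≤ n) {x y : List Bool}
    (hx : decodeNat x = n)
    (hy : ∀ (K : Type) [Field K] [NumberField K], Squarefree (decodeNat x) → 2 ≤ decodeNat x →
      Module.finrank ℚ K = 2 → (∃ α : K, α ^ 2 = (decodeNat x : K)) →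
        ∃ (m : ℕ) (w : List Bool),
          (m = ⌊NumberField.Units.regulator K⌋₊ ∨ m = ⌈NumberField.Units.regulator K⌉₊) ∧
            y = boolPair (encodeNat m) w) :
    ∃ (K : Type) (_ : Field K) (_ : NumberField K), Module.finrank ℚ K = 2 ∧
      (∃ α : K, α ^ 2 = (n : K)) ∧
      (bitsToNat (fstF y) = ⌊NumberField.Units.regulator K⌋₊ ∨
        bitsToNat (fstF y) = ⌈NumberField.Units.regulator K⌉₊) := by
  obtain ⟨K, _, _, hK, hα⟩ := exists_numberField_sq_eq_natCast hsf h2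
  rw [hx] at hy
  obtain ⟨m, w, hm, rfl⟩ := hy K hsf h2 hK hα
  refine ⟨K, inferInstance, inferInstance, hK, hα, ?_⟩
  rw [fstF_boolPair, bitsToNat_encodeNat]
  exact hm

/-! ### `(x + y√D)⁸` by three squarings, and residues modulo `9` -/

/-- `(x + y√D)² = (x² + Dy²) + 2xy·√D` on natural coordinates. [folklore] -/
theorem zsqrtd_sq_natCast (D x y : ℕ) :
    (⟨(x : ℤ), (y : ℤ)⟩ : ℤ√(D : ℤ)) ^ 2 = ⟨((x * x + D * (y * y) : ℕ) : ℤ), ((2 * (x * y) : ℕ) : ℤ)⟩ := by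
  rw [sq]
  ext
  · simp only [Zsqrtd.re_mul]; push_cast; ring
  · simp only [Zsqrtd.im_mul]; push_cast; ring

/-- **`(x + y√D)⁸` is polynomial time** on natural coordinates: some `P ∈ FP` (typed `CodeFP`) maps
`(D, x, y)` to the coordinates of `(x + y√D)⁸ ∈ ℕ[√D]` (three squarings `(x, y) ↦ (x² + Dy², 2xy)`).
[cite: AroraBarak2009, §1.3] -/
theorem exists_pow8Fn : ∃ P : ℕ × ℕ × ℕ → ℕ × ℕ,
    CodeFP (pairE natE (pairE natE natE)) (pairE natE natE) P ∧
    ∀ D x y : ℕ, ((P (D, x, y)).1 : ℤ) = ((⟨(x : ℤ), (y : ℤ)⟩ : ℤ√(D : ℤ)) ^ 8).re ∧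
      ((P (D, x, y)).2 : ℤ) = ((⟨(x : ℤ), (y : ℤ)⟩ : ℤ√(D : ℤ)) ^ 8).im := by
  -- one squaring step, context `D` kept: `(D, x, y) ↦ (D, x² + Dy², 2xy)`
  have hD : CodeFP (pairE natE (pairE natE natE)) natE (fun t : ℕ × ℕ × ℕ => t.1) := fst _ _
  have hx : CodeFP (pairE natE (pairE natE natE)) natE (fun t : ℕ × ℕ × ℕ => t.2.1) :=
    (fst _ _).comp (snd _ _)
  have hy : CodeFP (pairE natE (pairE natE natE)) natE (fun t : ℕ × ℕ × ℕ => t.2.2) :=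
    (snd _ _).comp (snd _ _)
  have hre : CodeFP (pairE natE (pairE natE natE)) natE
      (fun t : ℕ × ℕ × ℕ => t.2.1 * t.2.1 + t.1 * (t.2.2 * t.2.2)) :=
    (natAdd.comp ((natMul.comp (hx.pair hx)).pair (natMul.comp (hD.pair (natMul.comp (hy.pair hy)))))).congr
      fun _ => rfl
  have him : CodeFP (pairE natE (pairE natE natE)) natE (fun t : ℕ × ℕ × ℕ => 2 * (t.2.1 * t.2.2)) :=
    (natMul.comp ((const _ 2).pair (natMul.comp (hx.pair hy)))).congr fun _ => rfl
  have hstep : CodeFP (pairE natE (pairE natE natE)) (pairE natE (pairE natE natE))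
      (fun t : ℕ × ℕ × ℕ => (t.1, t.2.1 * t.2.1 + t.1 * (t.2.2 * t.2.2), 2 * (t.2.1 * t.2.2))) :=
    hD.pair (hre.pair him)
  have h3 := (snd _ _).comp (hstep.comp (hstep.comp hstep))
  refine ⟨_, h3, fun D x y => ?_⟩
  try dsimp only
  rw [show (8 : ℕ) = 2 * 2 * 2 from rfl, pow_mul, pow_mul, zsqrtd_sq_natCast, zsqrtd_sq_natCast, zsqrtd_sq_natCast]
  exact ⟨rfl, rfl⟩

/-- **Residues modulo `9` suffice**: `z = a + b√D` and `z' = (a mod 9) + (b mod 9)√D` have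
`z⁸ ≡ z'⁸ (mod 9ℤ[√D])` (`z − z' ∈ 9ℤ[√D]` divides `z⁸ − z'⁸`), coordinatewise. [folklore] -/
theorem zsqrtd_pow_eight_emod_nine (D a b : ℕ) :
    ((⟨(a : ℤ), (b : ℤ)⟩ : ℤ√(D : ℤ)) ^ 8).re % 9 =
        ((⟨((a % 9 : ℕ) : ℤ), ((b % 9 : ℕ) : ℤ)⟩ : ℤ√(D : ℤ)) ^ 8).re % 9 ∧
      ((⟨(a : ℤ), (b : ℤ)⟩ : ℤ√(D : ℤ)) ^ 8).im % 9 =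
        ((⟨((a % 9 : ℕ) : ℤ), ((b % 9 : ℕ) : ℤ)⟩ : ℤ√(D : ℤ)) ^ 8).im % 9 := by
  set z : ℤ√(D : ℤ) := ⟨(a : ℤ), (b : ℤ)⟩ with hz
  set z' : ℤ√(D : ℤ) := ⟨((a % 9 : ℕ) : ℤ), ((b % 9 : ℕ) : ℤ)⟩ with hz'
  have hsub : z - z' = ⟨9, 0⟩ * ⟨((a / 9 : ℕ) : ℤ), ((b / 9 : ℕ) : ℤ)⟩ := by
    have ha := Nat.mod_add_div a 9
    have hb := Nat.mod_add_div b 9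
    ext
    · simp only [hz, hz', Zsqrtd.re_sub, Zsqrtd.re_mul, mul_zero, zero_mul, add_zero]
      push_cast
      omega
    · simp only [hz, hz', Zsqrtd.im_sub, Zsqrtd.im_mul, zero_mul, add_zero]
      push_cast
      omega
  obtain ⟨w, hw⟩ : (⟨9, 0⟩ : ℤ√(D : ℤ)) ∣ z ^ 8 - z' ^ 8 :=
    (Dvd.intro _ hsub.symm).trans (sub_dvd_pow_sub_pow z z' 8)
  have h8 : z ^ 8 = z' ^ 8 + ⟨9, 0⟩ * w := by rw [← hw]; ring
  constructor
  · have := congrArg Zsqrtd.re h8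
    simp only [Zsqrtd.re_add, Zsqrtd.re_mul, mul_zero, zero_mul, add_zero] at this
    rw [this, Int.add_mul_emod_self_left]
  · have := congrArg Zsqrtd.im h8
    simp only [Zsqrtd.im_add, Zsqrtd.im_mul, zero_mul, add_zero] at this
    rw [this, Int.add_mul_emod_self_left]

/-- **The unit test is polynomial time, with its semantics**: some `U ∈ FP` (typed `CodeFP`) maps
`(d, D, x, y)` to the bit `[X ≡ 4 (mod 9) ∧ (3 ∣ d → 9 ∣ Y) ∧ (3 ∤ d → 3 ∣ Y)]`, `X + Y√D = (x + y√D)⁸`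
(`exists_pow8Fn` and three residue tests). [cite: AroraBarak2009, §1.3] -/
theorem exists_unitTestFn : ∃ U : ℕ × ℕ × ℕ × ℕ → Bool,
    CodeFP (pairE natE (pairE natE (pairE natE natE))) bitE U ∧
    ∀ d D x y : ℕ, U (d, D, x, y) = true ↔
      (((⟨(x : ℤ), (y : ℤ)⟩ : ℤ√(D : ℤ)) ^ 8).re % 9 = 4 ∧
        (3 ∣ d → (9 : ℤ) ∣ ((⟨(x : ℤ), (y : ℤ)⟩ : ℤ√(D : ℤ)) ^ 8).im) ∧
        (¬ 3 ∣ d → (3 : ℤ) ∣ ((⟨(x : ℤ), (y : ℤ)⟩ : ℤ√(D : ℤ)) ^ 8).im)) := by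
  obtain ⟨P, hP, hPspec⟩ := exists_pow8Fn
  have hd : CodeFP (pairE natE (pairE natE (pairE natE natE))) natE (fun t : ℕ × ℕ × ℕ × ℕ => t.1) := fst _ _
  have hrest : CodeFP (pairE natE (pairE natE (pairE natE natE))) (pairE natE (pairE natE natE))
      (fun t : ℕ × ℕ × ℕ × ℕ => t.2) := snd _ _
  have hPow : CodeFP (pairE natE (pairE natE (pairE natE natE))) (pairE natE natE)
      (fun t : ℕ × ℕ × ℕ × ℕ => P t.2) := hP.comp hrest
  have hX : CodeFP (pairE natE (pairE natE (pairE natE natE))) natE (fun t : ℕ × ℕ × ℕ × ℕ => (P t.2).1) :=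
    hPow.fst'
  have hY : CodeFP (pairE natE (pairE natE (pairE natE natE))) natE (fun t : ℕ × ℕ × ℕ × ℕ => (P t.2).2) :=
    hPow.snd'
  have hmod : ∀ {X : ℕ × ℕ × ℕ × ℕ → ℕ}, CodeFP (pairE natE (pairE natE (pairE natE natE))) natE X →
      ∀ k r : ℕ, CodeFP (pairE natE (pairE natE (pairE natE natE))) bitE (fun t => decide (X t % k = r)) :=
    fun hXf k r => natEq.comp ((natMod.comp (hXf.pair (const _ k))).pair (const _ r))
  have hU := (hmod hX 9 4).and ((hmod hd 3 0).ite (hmod hY 9 0) (hmod hY 3 0))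
  refine ⟨_, hU, fun d D x y => ?_⟩
  obtain ⟨hre, him⟩ := hPspec D x y
  dsimp only
  rw [← hre, ← him]
  have h3 : (3 ∣ d) ↔ d % 3 = 0 := Nat.dvd_iff_mod_eq_zero
  by_cases h3d : d % 3 = 0
  · rw [decide_eq_true h3d, if_pos rfl, Bool.and_eq_true, decide_eq_true_eq, decide_eq_true_eq]
    have h3d' : 3 ∣ d := h3.2 h3d
    constructor
    · rintro ⟨h4, h9⟩
      exact ⟨by omega, fun _ => by omega, fun h => absurd h3d' h⟩
    · rintro ⟨h4, h9, -⟩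
      have := h9 h3d'
      exact ⟨by omega, by omega⟩
  · rw [decide_eq_false h3d, if_neg Bool.false_ne_true, Bool.and_eq_true, decide_eq_true_eq, decide_eq_true_eq]
    have h3d' : ¬ 3 ∣ d := fun h => h3d (h3.1 h)
    constructor
    · rintro ⟨h4, h9⟩
      exact ⟨by omega, fun h => absurd h h3d', fun _ => by omega⟩
    · rintro ⟨h4, -, h9⟩
      have := h9 h3d'
      exact ⟨by omega, by omega⟩

/-- The residue test only sees the coordinates modulo `9`. [folklore] -/
theorem residue_test_congr {d : ℕ} {R R' I I' : ℤ} (hre : R % 9 = R' % 9) (him : I % 9 = I' % 9) :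
    (R' % 9 = 4 ∧ (3 ∣ d → (9:ℤ) ∣ I') ∧ (¬ 3 ∣ d → (3:ℤ) ∣ I')) ↔
      (R % 9 = 4 ∧ (3 ∣ d → (9:ℤ) ∣ I) ∧ (¬ 3 ∣ d → (3:ℤ) ∣ I)) := by
  have h9 : (9:ℤ) ∣ I' ↔ (9:ℤ) ∣ I := by omega
  have h3 : (3:ℤ) ∣ I' ↔ (3:ℤ) ∣ I := by omega
  have h4 : R' % 9 = 4 ↔ R % 9 = 4 := by omega
  rw [h9, h3, h4]

/-! ### The unit test on the fundamental solution decides `UnitCubeAtThree` -/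

/-- **The unit signature is a property of THE fundamental solution**: for `−d` fundamental, `d ≠ 3` and
`(a, b)` its mirror fundamental unit (`IsMirrorFundUnit d a b`, unique by `stub_mirrorUnitData`),
`UnitCubeAtThree d` is the residue test on `(a + b√d₀)⁸`. [cite: JacobsonWilliams2008, Ch. 12] -/
theorem unitCubeAtThree_iff_of_isMirrorFundUnit {d a b : ℕ}
    (hd : (((-(d:ℤ)) % 4 = 1 ∧ Squarefree (-(d:ℤ)) ∧ (-(d:ℤ)) ≠ 1) ∨
      (4 ∣ (-(d:ℤ)) ∧ ((-(d:ℤ)) / 4 % 4 = 2 ∨ (-(d:ℤ)) / 4 % 4 = 3) ∧ Squarefree ((-(d:ℤ)) / 4))))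
    (h3 : d ≠ 3) (hab : IsMirrorFundUnit d a b) :
    UnitCubeAtThree d ↔
      ((unitPow8 d a b).re % 9 = 4 ∧ (3 ∣ d → (9:ℤ) ∣ (unitPow8 d a b).im) ∧
        (¬ 3 ∣ d → (3:ℤ) ∣ (unitPow8 d a b).im)) := by
  obtain ⟨-, -, a₀, b₀, hab₀, huniq, -⟩ := stub_mirrorUnitData d hd h3
  obtain ⟨rfl, rfl⟩ := huniq a b hab
  constructor
  · rintro ⟨a', b', hab', h⟩
    obtain ⟨rfl, rfl⟩ := huniq a' b' hab'
    exact h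
  · exact fun h => ⟨a, b, hab, h⟩

/-! ### Polynomial-time pieces of the post-processor -/

/-- `fstF` on strings (private one-liner, as in `VanDamSeroussiOracleFP.lean`). [folklore] -/
private theorem codeFP_fstF : CodeFP strE strE fstF := ⟨fstF, fstF_mem_FP, fun _ => rfl⟩

/-- `sndF` on strings (private one-liner, as in `VanDamSeroussiOracleFP.lean`). [folklore] -/
private theorem codeFP_sndF : CodeFP strE strE sndF := ⟨sndF, sndF_mem_FP, fun _ => rfl⟩

/-- **The mirror radicand is polynomial time**: `d ↦ d₀ = mirrorRadicand d` (two divisibility tests,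
divisions and multiplications by constants). [folklore] -/
theorem codeFP_mirrorRadicand : CodeFP natE natE mirrorRadicand := by
  have hid : CodeFP natE natE (fun d : ℕ => d) := CodeFP.id natE
  have hdvd : ∀ k : ℕ, CodeFP natE bitE (fun d : ℕ => decide (d % k = 0)) := fun k =>
    natEq.comp ((natMod.comp (hid.pair (const _ k))).pair (const _ 0))
  have hdiv : ∀ k : ℕ, CodeFP natE natE (fun d : ℕ => d / k) := fun k => natDiv.comp (hid.pair (const _ k))
  have hmul : ∀ {g : ℕ → ℕ}, CodeFP natE natE g → CodeFP natE natE (fun d => 3 * g d) := fun hg =>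
    natMul.comp ((const _ 3).pair hg)
  refine (((hdvd 3).ite ((hdvd 4).ite (hdiv 12) (hdiv 3)) ((hdvd 4).ite (hmul (hdiv 4)) (hmul hid)))).congr
    fun d => ?_
  unfold mirrorRadicand
  simp only [← Nat.dvd_iff_mod_eq_zero, decide_eq_true_eq]

/-- **The post-processor is polynomial time** (plumbing in the typed `CodeFP` algebra): on `v = ⟨w, y⟩`,
with `d = ⟦fstF w⟧`, `d₀ = mirrorRadicand d`, `r = ⟦fstF y⟧`, `out = f ⟨bin d₀, ⟨bin r, bin 9⟩⟩`,
`x = ⟦fstF out⟧`, `y' = ⟦sndF out⟧`, the bit `good w ∧ U (d, d₀, x, y')` — for any `good`, `U` computed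
on codes in polynomial time and any `f ∈ FP`. [cite: AroraBarak2009, §1.3] -/
theorem exists_postFn {good : List Bool → Bool} {U : ℕ × ℕ × ℕ × ℕ → Bool} {f : List Bool → List Bool}
    (hgood : CodeFP strE bitE good) (hU : CodeFP (pairE natE (pairE natE (pairE natE natE))) bitE U)
    (hf : f ∈ FP) :
    ∃ post ∈ FP, ∀ w y : List Bool, post (boolPair w y) =
      [good w && U (bitsToNat (fstF w), mirrorRadicand (bitsToNat (fstF w)),
        bitsToNat (fstF (f (boolPair (encodeNat (mirrorRadicand (bitsToNat (fstF w))))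
          (boolPair (encodeNat (bitsToNat (fstF y))) (encodeNat 9))))),
        bitsToNat (sndF (f (boolPair (encodeNat (mirrorRadicand (bitsToNat (fstF w))))
          (boolPair (encodeNat (bitsToNat (fstF y))) (encodeNat 9))))))] := by
  have hw : CodeFP strE strE (fun v => fstF v) := codeFP_fstF
  have hy : CodeFP strE strE (fun v => sndF v) := codeFP_sndF
  have hd : CodeFP strE natE (fun v => bitsToNat (fstF (fstF v))) := strVal.comp (codeFP_fstF.comp hw)
  have hd0 : CodeFP strE natE (fun v => mirrorRadicand (bitsToNat (fstF (fstF v)))) :=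
    codeFP_mirrorRadicand.comp hd
  have hr : CodeFP strE natE (fun v => bitsToNat (fstF (sndF v))) := strVal.comp (codeFP_fstF.comp hy)
  -- the Jacobson–Williams call `f ⟨bin d₀, ⟨bin r, bin 9⟩⟩` as a string
  have hfcode : CodeFP (pairE natE (pairE natE natE)) strE (fun t : ℕ × ℕ × ℕ => f (pairE natE (pairE natE natE) t)) :=
    of_fn f hf fun _ => rfl
  have hout : CodeFP strE strE (fun v => f (boolPair (encodeNat (mirrorRadicand (bitsToNat (fstF (fstF v)))))
      (boolPair (encodeNat (bitsToNat (fstF (sndF v)))) (encodeNat 9)))) :=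
    (hfcode.comp (hd0.pair (hr.pair (const _ 9)))).congr fun _ => rfl
  have hx : CodeFP strE natE (fun v => bitsToNat (fstF (f (boolPair (encodeNat (mirrorRadicand (bitsToNat (fstF (fstF v)))))
      (boolPair (encodeNat (bitsToNat (fstF (sndF v)))) (encodeNat 9)))))) := strVal.comp (codeFP_fstF.comp hout)
  have hy' : CodeFP strE natE (fun v => bitsToNat (sndF (f (boolPair (encodeNat (mirrorRadicand (bitsToNat (fstF (fstF v)))))
      (boolPair (encodeNat (bitsToNat (fstF (sndF v)))) (encodeNat 9)))))) := strVal.comp (codeFP_sndF.comp hout)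
  have htest := hU.comp (hd.pair (hd0.pair (hx.pair hy')))
  obtain ⟨post, hpost, hspec⟩ := ((hgood.comp hw).and htest).recodeOut (eγ := strE) (g' := fun v =>
    [good (fstF v) && U (bitsToNat (fstF (fstF v)), mirrorRadicand (bitsToNat (fstF (fstF v))),
      bitsToNat (fstF (f (boolPair (encodeNat (mirrorRadicand (bitsToNat (fstF (fstF v)))))
        (boolPair (encodeNat (bitsToNat (fstF (sndF v)))) (encodeNat 9))))),
      bitsToNat (sndF (f (boolPair (encodeNat (mirrorRadicand (bitsToNat (fstF (fstF v)))))
        (boolPair (encodeNat (bitsToNat (fstF (sndF v)))) (encodeNat 9))))))]) fun _ => rfl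
  refine ⟨post, hpost, fun w y => ?_⟩
  have h := hspec (boolPair w y)
  simp only [strE, id, fstF_boolPair, sndF_boolPair] at h
  exact h

/-! ### The certified unit language is in `BQP` -/

/-- **The certified unit language `CU = {⟨bin d, code(primeFactorsList d)⟩ : −d fundamental, d ≠ 3,
UnitCubeAtThree d}` is in `BQP`, given a polynomial-time guard of its certificate part** (`good w = true` iff
`w = ⟨bin d, code(primeFactorsList d)⟩` with `−d` fundamental and `d ≠ 3`; supplied by `exists_goodFn` of
`…CertUnitChecks.lean`) — Hallgren's regulator algorithm (no GRH) in one classical wrap: guard, mirror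
radicand, Jacobson–Williams residues of the fundamental unit modulo `9`, the `(·)⁸` residue test; decision
from the written bit. [cite: Hallgren2007] [cite: Jozsa2003, §10 Thm 7] [cite: JacobsonWilliams2008, Ch. 12]
[cite: BernsteinVazirani1997, §8] -/
theorem certUnitLang_mem_BQP_of_guard
    (hguard : ∃ good : List Bool → Bool, CodeFP strE bitE good ∧ ∀ w : List Bool, good w = true ↔
      ∃ d : ℕ, w = boolPair (encodeNat d) (encodingListNatBool.encode (Nat.primeFactorsList d)) ∧
        ((((-(d:ℤ)) % 4 = 1 ∧ Squarefree (-(d:ℤ)) ∧ (-(d:ℤ)) ≠ 1) ∨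
          (4 ∣ (-(d:ℤ)) ∧ ((-(d:ℤ)) / 4 % 4 = 2 ∨ (-(d:ℤ)) / 4 % 4 = 3) ∧ Squarefree ((-(d:ℤ)) / 4)))) ∧
        d ≠ 3) :
    {w : List Bool | ∃ d : ℕ, w = boolPair (encodeNat d) (encodingListNatBool.encode (Nat.primeFactorsList d)) ∧
      ((((-(d:ℤ)) % 4 = 1 ∧ Squarefree (-(d:ℤ)) ∧ (-(d:ℤ)) ≠ 1) ∨
        (4 ∣ (-(d:ℤ)) ∧ ((-(d:ℤ)) / 4 % 4 = 2 ∨ (-(d:ℤ)) / 4 % 4 = 3) ∧ Squarefree ((-(d:ℤ)) / 4)))) ∧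
      d ≠ 3 ∧ UnitCubeAtThree d} ∈ BQP := by
  classical
  -- the classical pieces
  obtain ⟨good, hgood, hgood_iff⟩ := hguard
  obtain ⟨U, hU, hU_iff⟩ := exists_unitTestFn
  obtain ⟨f, hf, hJW⟩ := JacobsonWilliams2008_unitResidue_mem_FP_holds
  obtain ⟨post, hpost, hpost_eq⟩ := exists_postFn hgood hU hf
  obtain ⟨pre, hpre, hpre_eq⟩ := (strOfNat.comp (codeFP_mirrorRadicand.comp (strVal.comp codeFP_fstF)))
  -- the quantum search, wrapped
  have hW := isQSolvable_classicalWrap_holds pre post hpre hpost Hallgren2007_regulator_qsolvable_delim_holds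
  -- the language and its answer bit
  set CU : Set (List Bool) := {w : List Bool | ∃ d : ℕ,
      w = boolPair (encodeNat d) (encodingListNatBool.encode (Nat.primeFactorsList d)) ∧
      ((((-(d:ℤ)) % 4 = 1 ∧ Squarefree (-(d:ℤ)) ∧ (-(d:ℤ)) ≠ 1) ∨
        (4 ∣ (-(d:ℤ)) ∧ ((-(d:ℤ)) / 4 % 4 = 2 ∨ (-(d:ℤ)) / 4 % 4 = 3) ∧ Squarefree ((-(d:ℤ)) / 4)))) ∧
      d ≠ 3 ∧ UnitCubeAtThree d} with hCU
  have hbit : ∀ w, decide (w ∈ CU) = true ↔ w ∈ CU := fun w => decide_eq_true_iff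
  refine mem_BQP_of_isQSolvable_bit (fun _ _ => QCircuit.outputPMF_apply_holds) cliffordT_isUnitary_holds hbit
    (hW.mono fun w z hz => ?_)
  obtain ⟨y, hy, hz⟩ := hz
  -- it remains to see that the post-processor wrote `[w ∈ CU]`
  suffices hkey : post (boolPair w y) = [decide (w ∈ CU)] by rw [hkey] at hz; exact hz
  rw [hpost_eq]
  congr 1
  by_cases hg : good w = true
  · -- a well-formed query `⟨bin d, code(primeFactorsList d)⟩`, `−d` fundamental, `d ≠ 3`
    obtain ⟨d, rfl, hfund, h3⟩ := (hgood_iff w).1 hg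
    rw [hg, Bool.true_and]
    simp only [fstF_boolPair, bitsToNat_encodeNat]
    -- the mirror unit data
    obtain ⟨hsf, h2, a, b, hab, huniq, hreg⟩ := stub_mirrorUnitData d hfund h3
    -- Hallgren's answer: `r = ⟦fstF y⟧ ∈ {⌊R⌋, ⌈R⌉}` for a quadratic field `K ∋ √d₀`
    have hpre_w : pre (boolPair (encodeNat d) (encodingListNatBool.encode d.primeFactorsList)) =
        encodeNat (mirrorRadicand d) := by
      have h := hpre_eq (boolPair (encodeNat d) (encodingListNatBool.encode d.primeFactorsList))
      simp only [strE, id, fstF_boolPair, bitsToNat_encodeNat] at h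
      exact h
    simp only [Set.mem_setOf_eq, hpre_w] at hy
    obtain ⟨K, _, _, hK, hα, hr⟩ := exists_field_of_hallgrenAnswer hsf h2 (decode_encodeNat _) hy
    have hlog := hreg K hK hα (bitsToNat (fstF y)) hr
    -- Jacobson–Williams: the residues of the fundamental unit modulo `9`
    obtain ⟨hb, hsol, hmin⟩ := hab
    have hf9 := hJW (mirrorRadicand d) (bitsToNat (fstF y)) 9 a b hsf h2 (by norm_num) hb hsol hmin hlog
    rw [hf9, fstF_boolPair, sndF_boolPair, bitsToNat_encodeNat, bitsToNat_encodeNat]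
    -- the residue test on `(a mod 9, b mod 9)` is the test on `(a, b)`, i.e. `UnitCubeAtThree d`
    have hmem : boolPair (encodeNat d) (encodingListNatBool.encode d.primeFactorsList) ∈ CU ↔ UnitCubeAtThree d := by
      rw [hCU, Set.mem_setOf_eq]
      constructor
      · rintro ⟨d', h, -, -, hu⟩
        have hd := congrArg fstF h
        rw [fstF_boolPair, fstF_boolPair] at hd
        rw [natE_injective hd]
        exact hu
      · exact fun hu => ⟨d, rfl, hfund, h3, hu⟩
    obtain ⟨hre, him⟩ := zsqrtd_pow_eight_emod_nine (mirrorRadicand d) a b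
    apply Bool.eq_iff_iff.2
    rw [hU_iff, hbit, hmem, unitCubeAtThree_iff_of_isMirrorFundUnit hfund h3 ⟨hb, hsol, hmin⟩, unitPow8]
    exact residue_test_congr hre him
  · -- an ill-formed query: the guard rejects, and `w ∉ CU`
    have hg' : good w = false := by simpa using hg
    rw [hg', Bool.false_and]
    symm
    rw [decide_eq_false_iff_not]
    rintro ⟨d, rfl, hfund, h3, -⟩
    exact hg ((hgood_iff _).2 ⟨d, rfl, hfund, h3⟩)

end Summit.QuantumAdvantage.QuantumAdvantage.Theorems.AvgFaceBeyondPrior.Mirror
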